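import Summits.CriticalPhenomena.SAWScalingLimit.Theses.SAWRestrictionRigidity
import Literature.Probability.RandomPlanarGeometry.ConformalRestrictionProofs

/-!
# Stub `stub_covarianceOfCocycle` of line `registered` (scalar / avoidance-cocycle cut), crux `Rigidity` (stmt-CriticalPhenomena-1368), route SAWRestrictionRigidity

Target: `Summits/CriticalPhenomena/SAWScalingLimit/Theorems/SAWRestrictionRigidityRigidityCovarianceOfCocycle.lean` (`--supports stmt-CriticalPhenomena-1368`).
-/

noncomputable section

namespace Summit.CriticalPhenomena.SAWScalingLimit.Cruxes.Rigidity.Cocycle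

open MeasureTheory Set Filter Topology
open Literature.Probability.RandomPlanarGeometry

/-- **Conformal covariance from conformal invariance of the avoidance cocycle** (stub 5 of line `registered`, crux `Rigidity`): given the three bookkeeping statements (closure homeomorphism, push-forward of simple chords, preimage sub-domains) as hypotheses, a chordal family carried by simple boundary-avoiding chords whose avoidance probabilities `P D {γ ⊆ closure D'}` are invariant under conformal equivalences with the marked points as boundary values is conformally covariant: `Φ_* (P D)` and `P D₂` are probability laws on simple boundary-avoiding chords of `D₂` with equal avoidance probabilities of the sub-domains agreeing with `D₂` near the marks, hence equal (`AvoidanceDeterminesLaw_proof`, the LSW03 §3 analogue PROVED in the tree). [cite: LawlerSchrammWerner2003Restriction, §3 (the law of K is determined by P[K ∩ A = ∅])] -/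
theorem stub_covarianceOfCocycle : (∀ (D D₂ : Literature.Probability.RandomPlanarGeometry.DobrushinDomain) (g : Literature.Probability.RandomPlanarGeometry.ConformalEquiv D.carrier D₂.carrier) (Φ : C(ℂ, ℂ)), g.HasBoundaryValue (D.pt 0) (D₂.pt 0) → g.HasBoundaryValue (D.pt 1) (D₂.pt 1) → Set.EqOn Φ g D.carrier → Set.InjOn Φ (closure D.carrier) ∧ Φ '' D.carrier = D₂.carrier ∧ Φ '' closure D.carrier = closure D₂.carrier ∧ Φ '' frontier D.carrier = frontier D₂.carrier ∧ Φ (D.pt 0) = D₂.pt 0 ∧ Φ (D.pt 1) = D₂.pt 1 ∧ ContinuousOn (Function.invFunOn Φ (closure D.carrier)) (closure D₂.carrier) ∧ Set.EqOn (Function.invFunOn Φ (closure D.carrier)) g.symm D₂.carrier) → (∀ (D D₂ : Literature.Probability.RandomPlanarGeometry.DobrushinDomain) (Φ : C(ℂ, ℂ)) (μ : MeasureTheory.Measure (Literature.Probability.RandomPlanarGeometry.CurveClass ℂ)), Set.InjOn Φ (closure D.carrier) → Φ '' closure D.carrier = closure D₂.carrier → Φ '' frontier D.carrier = frontier D₂.carrier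 → Φ (D.pt 0) = D₂.pt 0 → Φ (D.pt 1) = D₂.pt 1 → (∀ᵐ γ ∂μ, γ ∈ Literature.Probability.RandomPlanarGeometry.CurveClass.simple ∧ γ.source = D.pt 0 ∧ γ.target = D.pt 1 ∧ γ.range ⊆ closure D.carrier ∧ γ.range ∩ frontier D.carrier ⊆ {D.pt 0, D.pt 1}) → ∀ᵐ γ ∂(μ.map (Literature.Probability.RandomPlanarGeometry.CurveClass.map Φ)), γ ∈ Literature.Probability.RandomPlanarGeometry.CurveClass.simple ∧ γ.source = D₂.pt 0 ∧ γ.target = D₂.pt 1 ∧ γ.range ⊆ closure D₂.carrier ∧ γ.range ∩ frontier D₂.carrier ⊆ {D₂.pt 0, D₂.pt 1}) → (∀ (D D₂ : Literature.Probability.RandomPlanarGeometry.DobrushinDomain) (Φ : C(ℂ, ℂ)), Set.InjOn Φ (closure D.carrier) → Φ '' closure D.carrier = closure D₂.carrier → Φ '' D.carrier = D₂.carrier → Φ (D.pt 0) = D₂.pt 0 → Φ (D.pt 1) = D₂.pt 1 → ContinuousOn (Function.invFunOn Φ (closure D.carrier)) (closure D₂.carrier) → ∀ D₂' : Literature.Probability.RandomPlanarGeometry.DobrushinDomain,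 D₂'.carrier ⊆ D₂.carrier → D₂'.pt 0 = D₂.pt 0 → D₂'.pt 1 = D₂.pt 1 → (∃ ε : ℝ, 0 < ε ∧ D₂'.carrier ∩ Metric.ball (D₂.pt 0) ε = D₂.carrier ∩ Metric.ball (D₂.pt 0) ε ∧ D₂'.carrier ∩ Metric.ball (D₂.pt 1) ε = D₂.carrier ∩ Metric.ball (D₂.pt 1) ε) → ∃ D' : Literature.Probability.RandomPlanarGeometry.DobrushinDomain, D'.carrier ⊆ D.carrier ∧ D'.pt 0 = D.pt 0 ∧ D'.pt 1 = D.pt 1 ∧ (∃ ε : ℝ, 0 < ε ∧ D'.carrier ∩ Metric.ball (D.pt 0) ε = D.carrier ∩ Metric.ball (D.pt 0) ε ∧ D'.carrier ∩ Metric.ball (D.pt 1) ε = D.carrier ∩ Metric.ball (D.pt 1) ε) ∧ Φ '' closure D'.carrier = closure D₂'.carrier ∧ ∀ γ : Literature.Probability.RandomPlanarGeometry.CurveClass ℂ, γ.range ⊆ closure D.carrier → (γ.range ⊆ closure D'.carrier ↔ Φ '' γ.range ⊆ closure D₂'.carrier)) → ∀ P : Literature.Probability.RandomPlanarGeometry.ChordalFamily,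 P.IsChordal → (∀ D : Literature.Probability.RandomPlanarGeometry.DobrushinDomain, ∀ᵐ γ ∂(P D), γ ∈ Literature.Probability.RandomPlanarGeometry.CurveClass.simple ∧ γ.range ∩ frontier D.carrier ⊆ {D.pt 0, D.pt 1}) → (∀ (D D₂ : Literature.Probability.RandomPlanarGeometry.DobrushinDomain) (g : Literature.Probability.RandomPlanarGeometry.ConformalEquiv D.carrier D₂.carrier) (Φ : C(ℂ, ℂ)), g.HasBoundaryValue (D.pt 0) (D₂.pt 0) → g.HasBoundaryValue (D.pt 1) (D₂.pt 1) → Set.EqOn Φ g D.carrier → Set.InjOn Φ (closure D.carrier) → ∀ (D' D₂' : Literature.Probability.RandomPlanarGeometry.DobrushinDomain), D'.carrier ⊆ D.carrier → D'.pt 0 = D.pt 0 → D'.pt 1 = D.pt 1 → D₂'.carrier ⊆ D₂.carrier → D₂'.pt 0 = D₂.pt 0 → D₂'.pt 1 = D₂.pt 1 → (∃ ε : ℝ, 0 < ε ∧ D'.carrier ∩ Metric.ball (D.pt 0) ε = D.carrier ∩ Metric.ball (D.pt 0) ε ∧ D'.carrier ∩ Metric.ball (D.pt 1) ε = D.carrier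 ∩ Metric.ball (D.pt 1) ε) → (∃ ε : ℝ, 0 < ε ∧ D₂'.carrier ∩ Metric.ball (D₂.pt 0) ε = D₂.carrier ∩ Metric.ball (D₂.pt 0) ε ∧ D₂'.carrier ∩ Metric.ball (D₂.pt 1) ε = D₂.carrier ∩ Metric.ball (D₂.pt 1) ε) → Φ '' closure D'.carrier = closure D₂'.carrier → P D (Literature.Probability.RandomPlanarGeometry.CurveClass.rangeSubset (closure D'.carrier)) = P D₂ (Literature.Probability.RandomPlanarGeometry.CurveClass.rangeSubset (closure D₂'.carrier))) → P.IsConformallyCovariant := by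
  intro hB1 hB3a hB3b P hch hsimple hcore D D₂ g Φ hb0 hb1 heq
  obtain ⟨hinj, hD, hcl, hfr, h0, h1, hΨc, _hΨg⟩ := hB1 D D₂ g Φ hb0 hb1 heq
  have hΦm : Measurable (CurveClass.map Φ) := CurveClass.measurable_map Φ
  haveI : IsProbabilityMeasure (P D) := (hch D).1
  haveI : IsProbabilityMeasure (P D₂) := (hch D₂).1
  haveI : IsProbabilityMeasure ((P D).map (CurveClass.map Φ)) :=
    Measure.isProbabilityMeasure_map hΦm.aemeasurable
  -- the full carrier statement for `P D` and `P D₂`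
  have hcarrier : ∀ D₀ : DobrushinDomain, ∀ᵐ γ ∂(P D₀), γ ∈ CurveClass.simple ∧
      γ.source = D₀.pt 0 ∧ γ.target = D₀.pt 1 ∧ γ.range ⊆ closure D₀.carrier ∧
      γ.range ∩ frontier D₀.carrier ⊆ {D₀.pt 0, D₀.pt 1} := by
    intro D₀
    filter_upwards [(hch D₀).2, hsimple D₀] with γ hγ hγ'
    exact ⟨hγ'.1, hγ.1, hγ.2.1, hγ.2.2, hγ'.2⟩
  -- (i) the push-forward is carried by simple boundary-avoiding chords of `D₂`
  have hμcar := hB3a D D₂ Φ (P D) hinj hcl hfr h0 h1 (hcarrier D)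
  -- (ii) `P D₂` is carried likewise (`hcarrier D₂`); (iv) `AvoidanceDeterminesLaw_proof` at `D₂`
  -- reduces `Φ_* (P D) = P D₂` to (iii): equal avoidance probabilities of the sub-domains `D₂'`
  symm
  refine Summit.CriticalPhenomena.SAWScalingLimit.Theorems.AvoidanceDeterminesLaw.AvoidanceDeterminesLaw_proof
    D₂ ((P D).map (CurveClass.map Φ)) (P D₂) inferInstance inferInstance hμcar (hcarrier D₂) ?_
  intro D₂' hsub h0' h1' hε
  obtain ⟨D', hsub', h0'', h1'', hε', hclD', hiff⟩ :=
    hB3b D D₂ Φ hinj hcl hD h0 h1 hΨc D₂' hsub h0' h1' hε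
  rw [Measure.map_apply hΦm (CurveClass.measurableSet_rangeSubset isClosed_closure)]
  have hae : (CurveClass.map Φ ⁻¹' CurveClass.rangeSubset (closure D₂'.carrier) : Set (CurveClass ℂ))
      =ᵐ[P D] CurveClass.rangeSubset (closure D'.carrier) := by
    filter_upwards [(hch D).2] with γ hγ
    have key : γ ∈ CurveClass.map Φ ⁻¹' CurveClass.rangeSubset (closure D₂'.carrier) ↔
        γ ∈ CurveClass.rangeSubset (closure D'.carrier) := by
      rw [Set.mem_preimage, CurveClass.mem_rangeSubset, CurveClass.mem_rangeSubset,
        CurveClass.range_map]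
      exact (hiff γ hγ.2.2).symm
    exact propext key
  rw [measure_congr hae]
  exact hcore D D₂ g Φ hb0 hb1 heq hinj D' D₂' hsub' h0'' h1'' hsub h0' h1' hε' hε hclD'

end Summit.CriticalPhenomena.SAWScalingLimit.Cruxes.Rigidity.Cocycle

end
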